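/-
Copyright (c) 2026. All rights reserved.
Released under Apache 2.0 license as described in the file LICENSE.
-/
import Literature.NumberTheory.Automorphic.QuaternionRamificationParity
import Literature.NumberTheory.QuadraticForms.HilbertReciprocityRat
import Literature.NumberTheory.Automorphic.BrandtModuleDictionary
import HarnessLib

/-!
# `(−1,−3)_ℚ` is ramified exactly at `3` and `∞`: `Ram_f (−1,−3)_ℚ = {3}` in the `IsSplitAt` language (the format of the
# Brandt setups `Brandt.XiSetup 1 3`), and `(−1,−3)_ℚ` is totally definite

[tag: quaternion_algebra] [tag: hilbert_symbol] [tag: ramification]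

Topic `NumberTheory/Automorphic`; THEOREMS ONLY (no definition, no named fact, no instance; net Literature debt `0`).
Lane `lit-hodgefound`, seat p12, gen 45 — second file of the series on the definite quaternion order of discriminant `3`
(after `MaximalOrderDiscThreeLattice`: the maximal order `O₃ = ℤ⟨1, i, ω, iω⟩` of Mathlib's `ℍ[ℚ,−1,−3]`, Voight Ex. 11.12).
A Brandt setup `Brandt.XiSetup N⁺ N⁻` asks for a totally definite quaternion algebra (`IsTotallyDefinite`),
`ramifiedPlaces ℚ D = {v | p_v ∣ N⁻}` with `N⁻` squarefree, and an Eichler order of level `N⁺`. This file supplies the two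
ramification clauses for `D = (−1,−3)_ℚ`, `N⁻ = 3`, from the tree's general theorems (`isSplitAt_iff_hilbertSymbol_eq_one`,
Serre's explicit signs `hilbertSymbol_rat_eq_localSign`, `isSplitAtInfinite_quaternionAlgebra_iff`), the only input specific
to `(−1,−3)_ℚ` being the Hilbert symbols `(−1,−3)_p` — exactly as `HurwitzOrderRamification` did for `(−1,−1)_ℚ`, `N⁻ = 2`:

* §1 `localSign_two_neg_one_neg_three` (**`(−1,−3)₂ = 1`**: `−3 ≡ 1 mod 4`, so `(−1)^{ε(−1)ε(−3)} = 1` — `B` is SPLIT at `2`),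
  `localSign_three_neg_one_neg_three` (**`(−1,−3)₃ = (−1∕3) = −1`**), `localSign_neg_one_neg_three_of_not_dvd` (`= 1` for
  `p ∤ 6`), `localSign_neg_one_neg_three_eq_one_iff` (`(−1,−3)_p = 1 ⟺ p ∤ 3`);
* §2 **`isSplitAt_iff_not_dvd_three`** (`B_v ≅ M₂(ℚ_v) ⟺ p_v ∤ 3`), **`ramifiedPlaces_eq`** (`Ram_f B = {v | p_v ∣ 3}` — the clause
  `ramifiedPlaces_eq` of `Brandt.XiSetup · 3`), `mem_ramifiedPlaces_iff_three_mem` (the `EichlerPackage` format `(3) ⊆ v`),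
  `not_isSplitAt_of_dvd_three`, `isSplitAt_of_not_dvd_three` — so `disc B = 3` and in particular `B ≄ (−1,−1 ∣ ℚ)`
  (Voight Ex. 11.12 (a), whose `Ram_f = {2}`: `HurwitzOrderRamification.ramifiedPlaces_eq`);
* §3 **`isTotallyDefinite`** (`X² + Y² = −3` has no real solution).

## Sources

* J. Voight, *Quaternion Algebras*, GTM 288 (2021), Exercise 11.12 (a) («`B := (−1,−3 ∣ ℚ)` … Show that `B ≄ (−1,−1 ∣ ℚ)`»),
  11.5.11 («`B ≃ (−3,−1 ∣ ℚ)`»), Thm. 25.4.1 (`D = 3`). [cite: Voight2021, Exercise 11.12 (a); 11.5.11; Thm. 25.4.1]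
* J.-P. Serre, *A Course in Arithmetic* (1973), Ch. III §1.2 Thm. 1 (the explicit Hilbert symbols over `ℚ_p` and `ℝ`).
  [cite: Serre1973, Ch. III §1.2 Thm. 1]
* M.-F. Vignéras, *Arithmétique des algèbres de quaternions*, LNM 800 (1980), Ch. II §1 Thm. 1.1 («`Ram(H) = {v, H_v est un
  corps}`»), Ch. III §1 Exemple («`Ram{a,b} = {v, (a,b)_v = −1}`»), Ch. III §3 (définie = ramifiée aux places infinies).
  [cite: VignerasLNM800, Ch. II §1 Thm. 1.1; Ch. III §1 Exemple; Ch. III §3]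

## Scope (honest)

Theorems only — no definition, no named fact, no instance. Everything is the tree's general theory specialised to
`D = ℍ[ℚ,−1,−3]`; the Brandt setup itself (a structure VALUE) is assembled in the sequel.
-/

open Quaternion
open scoped Pointwise
open IsDedekindDomain NumberField
open Literature.NumberTheory.Automorphic.Brandt
open Literature.NumberTheory.QuadraticForms

namespace Literature.NumberTheory.Automorphic.MaxOrderDiscThree

/-! ## §1 The Hilbert symbols `(−1,−3)_p` -/

section Signs

/-- **`(−1,−3)₂ = 1`** (`−1`, `−3` are `2`-adic units and `−3 ≡ 1 (mod 4)`: `(−1)^{ε(−1)ε(−3)} = 1`) — `(−1,−3)_ℚ` is split at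
`2`. [cite: Serre1973, Ch. III §1.2 Thm. 1] -/
theorem localSign_two_neg_one_neg_three : localSign 2 (-1) (-3) = 1 := by
  rw [localSign, if_pos rfl, localSignTwo_of_odd (by norm_num) (by norm_num), epsSign_neg_one_left]
  have : ¬ ZMod.χ₄ ((-3 : ℤ) : ZMod 4) = -1 := by decide
  rw [if_neg this]

/-- **`(−1,−3)₃ = (−1∕3) = −1`** (`−3 = 3¹·(−1)`, `−1` a `3`-adic unit and a non-residue mod `3`). [cite: Serre1973, Ch. III §1.2 Thm. 1] -/
theorem localSign_three_neg_one_neg_three : localSign 3 (-1) (-3) = -1 := by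
  haveI : Fact (Nat.Prime 3) := ⟨Nat.prime_three⟩
  rw [localSign, if_neg (by norm_num), localSignOdd_def]
  have h3 := padicValInt_eq_of_eq_pow_mul (p := 3) (a := -3) (u := -1) (n := 1) (by norm_num) (by norm_num)
  rw [h3.1, h3.2, padicValInt_neg_one, primeCompl_neg_one]
  have hm1 : legendreSym 3 (-1) = -1 := by
    rw [legendreSym.at_neg_one (p := 3) (by decide)]; decide
  simp [hm1]

/-- **`(−1,−3)_p = 1` for `p ∤ 6`** (both entries are `p`-adic units, `p` odd). [cite: Serre1973, Ch. III §1.2 Thm. 1] -/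
theorem localSign_neg_one_neg_three_of_not_dvd {p : ℕ} (hp : p.Prime) (hp6 : ¬ p ∣ 6) : localSign p (-1) (-3) = 1 := by
  refine localSign_eq_one_of_not_dvd hp fun h => hp6 ?_
  have h' : (p : ℤ) ∣ 6 := by
    have e : (2 : ℤ) * -1 * -3 = 6 := by norm_num
    rwa [e] at h
  exact_mod_cast h'

/-- **`(−1,−3)_p = 1 ⟺ p ∤ 3`** (`p` prime): the only finite place where the symbol is `−1` is `p = 3`. [cite: Serre1973, Ch. III §1.2 Thm. 1] [cite: VignerasLNM800, Ch. III §1 Exemple] -/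
theorem localSign_neg_one_neg_three_eq_one_iff {p : ℕ} (hp : p.Prime) : localSign p (-1) (-3) = 1 ↔ ¬ p ∣ 3 := by
  constructor
  · intro h hp3
    have := (Nat.prime_dvd_prime_iff_eq hp Nat.prime_three).1 hp3
    subst this
    rw [localSign_three_neg_one_neg_three] at h
    norm_num at h
  · intro hp3
    by_cases hp2 : p = 2
    · subst hp2
      exact localSign_two_neg_one_neg_three
    · refine localSign_neg_one_neg_three_of_not_dvd hp fun h6 => ?_
      have h6' : p ∣ 2 * 3 := h6
      rcases (Nat.Prime.dvd_mul hp).1 h6' with h2 | h3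
      · exact hp2 ((Nat.prime_dvd_prime_iff_eq hp Nat.prime_two).1 h2)
      · exact hp3 h3

end Signs

/-! ## §2 `Ram_f (−1,−3)_ℚ = {3}` -/

section Ramification

/-- **`B = (−1,−3)_ℚ` is split at the finite place `v` iff `p_v ∤ 3`** (`B_v ≅ M₂(ℚ_v) ⟺ (−1,−3)_v = 1`).
[cite: VignerasLNM800, Ch. II §1 Thm. 1.1 and Ch. III §1 Exemple] [cite: Serre1973, Ch. III §1.2 Thm. 1] -/
theorem isSplitAt_iff_not_dvd_three (v : HeightOneSpectrum (𝓞 ℚ)) :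
    IsSplitAt ℍ[ℚ,-1,-3] v ↔ ¬ Rat.HeightOneSpectrum.natGenerator v ∣ 3 := by
  have h := isSplitAt_iff_hilbertSymbol_eq_one ℚ ℍ[ℚ,-1,-3] (a := (-1 : ℚ)) (b := (-3 : ℚ)) (by norm_num) (by norm_num)
    AlgEquiv.refl v
  have hs := hilbertSymbol_rat_eq_localSign v (a := -1) (b := -3) (by norm_num) (by norm_num)
  have e1 : ((-1 : ℤ) : ℚ) = -1 := by norm_num
  have e3 : ((-3 : ℤ) : ℚ) = -3 := by norm_num
  rw [e1, e3] at hs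
  rw [h, hs, ← localSign_neg_one_neg_three_eq_one_iff (Rat.HeightOneSpectrum.prime_natGenerator v)]

/-- **`Ram_f (−1,−3)_ℚ = {v | p_v ∣ 3}`: the discriminant of `(−1,−3)_ℚ` is `3`** — the ramification clause of the Brandt
setups `Brandt.XiSetup · 3` (Voight Thm. 25.4.1, `D = 3`; in particular `B ≄ (−1,−1 ∣ ℚ)`, Ex. 11.12 (a)).
[cite: VignerasLNM800, Ch. III §1 Exemple] [cite: Voight2021, Exercise 11.12 (a) and Thm. 25.4.1] -/
theorem ramifiedPlaces_eq :
    ramifiedPlaces ℚ ℍ[ℚ,-1,-3] = {v | ((Rat.HeightOneSpectrum.primesEquiv v : Nat.Primes) : ℕ) ∣ 3} := by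
  ext v
  rw [mem_ramifiedPlaces_iff, isSplitAt_iff_not_dvd_three, not_not]
  rfl

/-- **`v ∈ Ram(B) ⟺ (3) ⊆ v`** — the ramification hypothesis in the `EichlerPackage` format. [cite: VignerasLNM800, Ch. III §1 Exemple] -/
theorem mem_ramifiedPlaces_iff_three_mem (v : HeightOneSpectrum (𝓞 ℚ)) :
    v ∈ ramifiedPlaces ℚ ℍ[ℚ,-1,-3] ↔ ((3 : ℕ) : 𝓞 ℚ) ∈ v.asIdeal := by
  rw [ramifiedPlaces_eq, Set.mem_setOf_eq, primesEquiv_dvd_iff]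

/-- `(−1,−3)_ℚ` is NOT split at the place over `3`. [cite: VignerasLNM800, Ch. III §1 Exemple] -/
theorem not_isSplitAt_of_dvd_three {v : HeightOneSpectrum (𝓞 ℚ)} (hv : Rat.HeightOneSpectrum.natGenerator v ∣ 3) :
    ¬ IsSplitAt ℍ[ℚ,-1,-3] v := by
  rw [isSplitAt_iff_not_dvd_three, not_not]
  exact hv

/-- `(−1,−3)_ℚ` IS split at every place not over `3` (in particular at `2`). [cite: VignerasLNM800, Ch. III §1 Exemple] -/
theorem isSplitAt_of_not_dvd_three {v : HeightOneSpectrum (𝓞 ℚ)} (hv : ¬ Rat.HeightOneSpectrum.natGenerator v ∣ 3) :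
    IsSplitAt ℍ[ℚ,-1,-3] v :=
  (isSplitAt_iff_not_dvd_three v).2 hv

end Ramification

/-! ## §3 `(−1,−3)_ℚ` is totally definite -/

section Definite

/-- **`(−1,−3)_ℚ` is totally definite**: it is ramified at the real place of `ℚ` — were `ℝ ⊗ B ≅ M₂(ℝ)`, the equation
`X² + Y² = −3` would be solvable in `ℚ_∞ = ℝ`. [cite: VignerasLNM800, Ch. III §3 (algèbre totalement définie)] [cite: Serre1973, Ch. III §1.2 Thm. 1 (`(−1,−3)_∞ = −1`)] -/
theorem isTotallyDefinite : IsTotallyDefinite ℚ ℍ[ℚ,-1,-3] := by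
  intro w hw
  have hwr : w.IsReal := IsTotallyReal.isReal w
  obtain ⟨x, y, hxy⟩ := (isSplitAtInfinite_quaternionAlgebra_iff (K := ℚ) (a := (-1 : ℚ)) (b := (-3 : ℚ))
    (by norm_num) (by norm_num) w).1 hw
  rw [map_neg, map_one, map_neg, map_ofNat] at hxy
  have h2 := congr_arg (InfinitePlace.Completion.extensionEmbeddingOfIsReal hwr) hxy
  simp only [map_sub, map_mul, map_pow, map_neg, map_one, map_ofNat] at h2
  nlinarith [sq_nonneg (InfinitePlace.Completion.extensionEmbeddingOfIsReal hwr x),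
    sq_nonneg (InfinitePlace.Completion.extensionEmbeddingOfIsReal hwr y)]

end Definite

end Literature.NumberTheory.Automorphic.MaxOrderDiscThree
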